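import Literature.NumberTheory.Automorphic.PicardCMPrerequisites
import Literature.NumberTheory.Automorphic.GodementCompactness
import Literature.NumberTheory.GaloisRepresentations.HeckeCharacterArchTypeProofs
import HarnessLib

/-!
# `PicardCM.CompactUnitaryQuotient` holds (fact discharged)

Topic `NumberTheory/Automorphic`; namespace `Literature.NumberTheory.Automorphic`. **No named facts,
no `sorry`**, imports = tree only.

The named fact `PicardCM.CompactUnitaryQuotient` of `PicardCMPrerequisites` — for a CM number field
`L`, a hermitian ANISOTROPIC `H ∈ M_k(L)`, the quotient `adelicUnitaryGroup L H ⧸ adelicUnitaryRat L H`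
(`U(H)(L⁺)\U(H)(𝔸_{L⁺})`) is compact — is a THEOREM of the tree: Godement's compactness criterion
for anisotropic unitary groups, `Godement.compactSpace_adelicUnitaryQuot` (`GodementCompactness`,
kernel proof via the Mahler–Godement criterion for `GL_n` and a height floor). This file records the
discharge, so `PicardCMPrerequisites` needs only its conjuncts (ii)–(iv) as hypotheses
(`picardCMPrerequisites_of_rest`). The hermitian hypothesis of the record is not used by the proof.
Conjunct (iv), `HeckeCharacter.exists_of_unitaryArchParams_iff` (Weil 1956 / Patrikis 2019
Lemma 2.1.1: Hecke characters with prescribed unitary archimedean parameters), is likewise already a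
tree theorem (`HeckeCharacter.exists_of_unitaryArchParams_iff_holds`, via Chevalley's congruence
theorem for units `Chevalley1951.thm1_units_holds`), whence `picardCMPrerequisites_of_geometry`:
the bundle reduces to its two GEOMETRIC conjuncts (ii) ball quotients algebraic, (iii) CM abelian
varieties realised.

## References

* R. Godement, *Domaines fondamentaux des groupes arithmétiques*, Sém. Bourbaki 257 (1962/63),
  Thm. 4.2 (proved in the tree as `Godement.compactSpace_adelicUnitaryQuot`).
* J. Getz, H. Hahn, *An Introduction to Automorphic Representations*, GTM 300 (2024), Thm. 2.6.2
  p. 46 (the source cited by the record). [GetzHahn2024]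
* S. Patrikis, *Variations on a theorem of Tate*, Mem. AMS 1238 (2019), Lemma 2.1.1 (proved in the
  tree as `HeckeCharacter.exists_of_unitaryArchParams_iff_holds`). [Patrikis2019]
-/

noncomputable section

namespace Literature.NumberTheory.Automorphic

/-- **`PicardCM.CompactUnitaryQuotient` holds**: compactness of `U(H)(L⁺)\U(H)(𝔸_{L⁺})` for
anisotropic `H` over a CM field is the tree theorem `Godement.compactSpace_adelicUnitaryQuot` (the
hermitian hypothesis is not needed). [folklore] -/
theorem PicardCM.compactUnitaryQuotient_holds : PicardCM.CompactUnitaryQuotient :=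
  fun L _ _ _ _ H _ hanis => Godement.compactSpace_adelicUnitaryQuot L H hanis

/-- `PicardCMPrerequisites` from its conjuncts (ii)–(iv) alone, conjunct (i) being a theorem.
[folklore] -/
theorem picardCMPrerequisites_of_rest (h₂ : PicardCM.BallQuotientAlgebraic)
    (h₃ : PicardCM.CMAbelianVarietyRealised)
    (h₄ : GaloisRepresentations.HeckeCharacter.exists_of_unitaryArchParams_iff) :
    PicardCMPrerequisites :=
  picardCMPrerequisites_of PicardCM.compactUnitaryQuotient_holds h₂ h₃ h₄

/-- `PicardCMPrerequisites` from its two GEOMETRIC conjuncts (ii), (iii): conjuncts (i) (Godement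
compactness) and (iv) (Hecke characters with prescribed unitary archimedean type) are theorems of
the tree. [folklore] -/
theorem picardCMPrerequisites_of_geometry (h₂ : PicardCM.BallQuotientAlgebraic)
    (h₃ : PicardCM.CMAbelianVarietyRealised) : PicardCMPrerequisites :=
  picardCMPrerequisites_of PicardCM.compactUnitaryQuotient_holds h₂ h₃
    GaloisRepresentations.HeckeCharacter.exists_of_unitaryArchParams_iff_holds

/-- Conversely the bundle is now EQUIVALENT to its two geometric conjuncts. [folklore] -/
theorem picardCMPrerequisites_iff_geometry :
    PicardCMPrerequisites ↔
      PicardCM.BallQuotientAlgebraic ∧ PicardCM.CMAbelianVarietyRealised :=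
  ⟨fun h => ⟨h.2.1, h.2.2.1⟩, fun h => picardCMPrerequisites_of_geometry h.1 h.2⟩

end Literature.NumberTheory.Automorphic

end
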